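import Mathlib.Analysis.SpecialFunctions.Sqrt
import Mathlib.Analysis.SpecialFunctions.Pow.Deriv
import Mathlib.Analysis.Calculus.ContDiff.Operations
import Mathlib.Analysis.Normed.Group.Bounded
import Literature.Analysis.FluidPDE.BeltramiDirections
import Literature.Analysis.FluidPDE.NashGeometricLemma
import HarnessLib

/-!
# The geometric lemma in Beltrami form (Luo–Titi 2020, Prop. 2; Buckmaster–Vicol 2019, Prop. 3.2)

Analysis/FluidPDE support file, second building block of the intermittent convex-integration
scheme of Buckmaster–Vicol in the explicit form of T. Luo and E. S. Titi, Calc. Var. PDE 59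
(2020) = arXiv:1808.07595, §3.2, **Proposition 2**:

> Let `B_ε(Id)` denote the ball of symmetric matrices, centered at the identity, of radius `ε`.
> Then there exist a constant `ε_γ > 0` and smooth positive functions
> `γ_(ξ) ∈ C^∞(B_{ε_γ}(Id))`, such that (1) `γ_(ξ) = γ_(-ξ)`; (2) for each `R ∈ B_{ε_γ}(Id)`
> we have the identity `R = ½ ∑_{ξ ∈ Λ} (γ_(ξ)(R))² (Id - ξ ⊗ ξ)`.

("a simple variant of [BV17]": Buckmaster–Vicol, Ann. of Math. 189 (2019), Prop. 3.2, with a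
single family `Λ`, `|Λ| = 12`, cf. their Remark 3.3.) Here `Λ = Λ⁺ ∪ Λ⁻` is the direction set
of `BeltramiDirections` (`dir : LIndex → ℝ³`, `Λ⁺` indexed by `PIndex = Fin 3 × Bool`).

Everything is PROVED, with explicit data, in the style of the tree's `NashGeometricLemma`
(rank-one form `k ⊗ k`, CL22 Lemma 4.2): since the summand is even in `ξ`,
`½ ∑_Λ γ_ξ² (Id - ξ⊗ξ) = ∑_{Λ⁺} γ_ξ² (Id - ξ⊗ξ)`, and the six matrices `Id - ξ ⊗ ξ`, `ξ ∈ Λ⁺`,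
form a BASIS of the symmetric `3 × 3` matrices; the squared coefficients are therefore the
(affine-)linear coordinate functionals `coeffSq`:

* off-diagonal: `γ²_{(i,+)} - γ²_{(i,-)} = -(25/12) R_{i,i+1}` (the only directions with a
  non-zero `(i, i+1)` entry of `ξ ⊗ ξ` are `(3e_i ± 4e_{i+1})/5`, entry `±12/25`);
* diagonal: the pair sums `u_i = γ²_{(i,+)} + γ²_{(i,-)}` solve the circulant system
  `16u_i + 25u_{i+1} + 9u_{i+2} = 25R_ii` (determinant `9650 ≠ 0`), i.e.
  `u_i = (31R_ii - 319R_{i+1,i+1} + 481R_{i+2,i+2})/386` (`pairSum`);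

at `R = Id` all `γ_ξ² = 1/4` (`coeffSq_idMat`; consistent with `(1/8)∑_Λ(Id - ξ⊗ξ) = Id`).
With `ε_γ = radius = 1/20` for the sup-metric on the entries (sup-balls contain the
Frobenius/operator-norm balls of the same radius, so the printed metric balls are covered):
`γ_ξ² > 0` on `B̄(Id, 2ε_γ)` (`coeffSq_pos`), `γ_ξ² ≥ 1/8` on `B̄(Id, ε_γ)` (`le_coeffSq`),
`γ_ξ = √(γ_ξ²)` is `C^∞` on the open ball `B(Id, 2ε_γ)` (`contDiffOn_gamma`), the identity (2)
holds with genuine squares on `B̄(Id, 2ε_γ)` (`decomposition`, and over `Λ⁺`: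
`decomposition_plus`), all derivatives of `γ_ξ` are bounded on `B̄(Id, ε_γ)`
(`exists_bound_iteratedFDeriv_coeff`; BV19 Prop. 3.2: "with derivatives that are bounded"), and
`geometric_lemma` packages Prop. 2 in its printed shape.

## Design

* Matrices are elements of the Pi type `Fin 3 → Fin 3 → ℝ` (sup norm, the instance under which
  `ContDiff` is canonical), `Id = NashGeometric.idMat`, symmetry as a hypothesis — exactly as in
  `NashGeometricLemma`.
* The linear identity `sum_coeffSq_mul` holds for EVERY matrix (right-hand side `(R + Rᵀ)/2`);
  symmetry and smallness enter only when square roots are taken.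

## References

* T. Luo, E. S. Titi, Calc. Var. PDE 59 (2020) = arXiv:1808.07595, §3.2 Prop. 2. [`LuoTiti2020`]
* T. Buckmaster, V. Vicol, Ann. of Math. 189 (2019) = arXiv:1709.10033, §3.1 Prop. 3.2 and
  Remark 3.3. [`BuckmasterVicol2019AnnMath`]
* A. Cheskidov, X. Luo, Invent. Math. 229 (2022), Lemma 4.2 (the rank-one analogue, tree file
  `NashGeometricLemma`). [`CheskidovLuo2022`]
-/

noncomputable section

namespace Literature.Analysis.FluidPDE.IntermittentBeltrami

open Set Metric Finset
open scoped ContDiff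

open NashGeometric (idMat idMat_apply_self idMat_apply_of_ne abs_sub_idMat_le)

/-! ## The squared coefficients: explicit affine functionals -/

/-- The radius `ε_γ = 1/20` (sup-metric on the entries) of Luo–Titi's Prop. 2 in the present
explicit construction. [cite: LuoTiti2020, §3.2 Prop. 2] -/
def radius : ℝ := 1 / 20

/-- The "pair sums" `u_i(R) = γ²_{(i,+)}(R) + γ²_{(i,-)}(R)`: the solution of the circulant
system `16u_i + 25u_{i+1} + 9u_{i+2} = 25 R_ii` expressing the diagonal of
`∑_{Λ⁺} γ_ξ² (Id - ξ⊗ξ) = R`, namely `u_i = (31R_ii - 319R_{i+1,i+1} + 481R_{i+2,i+2})/386`. [folklore] -/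
def pairSum (R : Fin 3 → Fin 3 → ℝ) : Fin 3 → ℝ :=
  ![(31 * R 0 0 - 319 * R 1 1 + 481 * R 2 2) / 386,
    (481 * R 0 0 + 31 * R 1 1 - 319 * R 2 2) / 386,
    (-319 * R 0 0 + 481 * R 1 1 + 31 * R 2 2) / 386]

/-- The symmetrised off-diagonal entries `R_{i,i+1} + R_{i+1,i}`. [folklore] -/
def offDiag (R : Fin 3 → Fin 3 → ℝ) : Fin 3 → ℝ :=
  ![R 0 1 + R 1 0, R 1 2 + R 2 1, R 2 0 + R 0 2]

/-- **The squared coefficients `γ_ξ(R)²` for `ξ = (3e_i + s_b 4e_{i+1})/5 ∈ Λ⁺`**, AFFINE in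
`R`: `γ²_{(i,b)}(R) = u_i(R)/2 - s_b (25/48)(R_{i,i+1} + R_{i+1,i})`; at `R = Id` all equal
`1/4`. [cite: LuoTiti2020, §3.2 Prop. 2] -/
def coeffSq (R : Fin 3 → Fin 3 → ℝ) (x : PIndex) : ℝ :=
  pairSum R x.1 / 2 - (if x.2 then 1 else -1) * (25 / 48) * offDiag R x.1

/-- The coefficient `γ_ξ = √(γ_ξ²)` on `Λ⁺` (a genuine square root where `γ_ξ² ≥ 0`, in
particular on `B̄(Id, 1/10)`). [cite: LuoTiti2020, §3.2 Prop. 2] -/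
def coeff (x : PIndex) (R : Fin 3 → Fin 3 → ℝ) : ℝ := Real.sqrt (coeffSq R x)

/-- The coefficient `γ_ξ` on `Λ = Λ⁺ ∪ Λ⁻`, even under `ξ ↦ -ξ` by definition
(`γ_{-ξ} = γ_ξ`). [cite: LuoTiti2020, §3.2 Prop. 2] -/
def gamma (y : LIndex) (R : Fin 3 → Fin 3 → ℝ) : ℝ := coeff y.1 R

/-- `γ_ξ(Id)² = 1/4` for every `ξ ∈ Λ⁺`. [folklore] -/
theorem coeffSq_idMat (x : PIndex) : coeffSq idMat x = 1 / 4 := by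
  obtain ⟨i, b⟩ := x
  fin_cases i <;> cases b <;>
    simp [coeffSq, pairSum, offDiag, idMat_apply_self, idMat_apply_of_ne] <;> norm_num

/-! ## The linear identity and the decomposition -/

/-- **The linear identity**: for EVERY `3 × 3` matrix `R` (no symmetry, no smallness),
`∑_{ξ ∈ Λ⁺} γ_ξ(R)² (δ_ab - ξ_a ξ_b) = (R_ab + R_ba)/2`. [cite: LuoTiti2020, §3.2 Prop. 2] -/
theorem sum_coeffSq_mul (R : Fin 3 → Fin 3 → ℝ) (a b : Fin 3) :
    ∑ x : PIndex, coeffSq R x * ((if a = b then (1 : ℝ) else 0) - dirPlus x a * dirPlus x b) =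
      (R a b + R b a) / 2 := by
  fin_cases a <;> fin_cases b <;>
    simp [Fintype.sum_prod_type, Fin.sum_univ_three, coeffSq, pairSum, offDiag, dirPlus,
      intDirPlus, four] <;> ring

/-- The sum over `Λ` is twice the sum over `Λ⁺` (the summands are even in `ξ`):
`(1/2) ∑_{ξ ∈ Λ} γ_ξ² (δ_ab - ξ_aξ_b) = ∑_{ξ ∈ Λ⁺} γ_ξ² (δ_ab - ξ_aξ_b)`. [folklore] -/
theorem half_sum_lIndex (c : PIndex → ℝ) (a b : Fin 3) :
    (1 / 2 : ℝ) * ∑ y : LIndex, c y.1 * ((if a = b then (1 : ℝ) else 0) - dir y a * dir y b) =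
      ∑ x : PIndex, c x * ((if a = b then (1 : ℝ) else 0) - dirPlus x a * dirPlus x b) := by
  simp_rw [dir_mul_dir]
  rw [Fintype.sum_prod_type]
  simp only [Fintype.sum_bool]
  rw [Finset.mul_sum]
  refine Finset.sum_congr rfl fun x _ => ?_
  ring

/-- **The identity of Prop. 2 at the level of the affine `γ²`**: for every SYMMETRIC `R`,
`R = (1/2) ∑_{ξ ∈ Λ} γ_ξ(R)² (Id - ξ ⊗ ξ)` entrywise (no smallness needed before taking
square roots). [cite: LuoTiti2020, §3.2 Prop. 2] -/
theorem eq_half_sum_coeffSq (R : Fin 3 → Fin 3 → ℝ) (hsym : ∀ i j, R i j = R j i) (a b : Fin 3) :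
    R a b = (1 / 2 : ℝ) * ∑ y : LIndex, coeffSq R y.1 * ((if a = b then (1 : ℝ) else 0) - dir y a * dir y b) := by
  rw [half_sum_lIndex (coeffSq R), sum_coeffSq_mul, ← hsym a b]
  ring

/-! ## Signs of the squared coefficients near `Id` -/

/-- Entry bounds in the sup-ball: `|R_ii - 1| ≤ ε` and `|R_ij| ≤ ε` (`i ≠ j`). [folklore] -/
theorem entry_bounds {R : Fin 3 → Fin 3 → ℝ} {ε : ℝ} (hR : dist R idMat ≤ ε) :
    |R 0 0 - 1| ≤ ε ∧ |R 1 1 - 1| ≤ ε ∧ |R 2 2 - 1| ≤ ε ∧ |R 0 1| ≤ ε ∧ |R 1 0| ≤ ε ∧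
      |R 1 2| ≤ ε ∧ |R 2 1| ≤ ε ∧ |R 2 0| ≤ ε ∧ |R 0 2| ≤ ε := by
  have hd : ∀ i, |R i i - 1| ≤ ε := fun i => by simpa using abs_sub_idMat_le hR i i
  have ho : ∀ i j, i ≠ j → |R i j| ≤ ε := fun i j hij => by
    simpa [idMat_apply_of_ne hij] using abs_sub_idMat_le hR i j
  exact ⟨hd 0, hd 1, hd 2, ho 0 1 (by decide), ho 1 0 (by decide), ho 1 2 (by decide),
    ho 2 1 (by decide), ho 2 0 (by decide), ho 0 2 (by decide)⟩

/-- **Positivity on `B̄(Id, 1/10) = B̄(Id, 2ε_γ)`**: every `γ_ξ(R)² > 0` there (indeed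
`γ² ≥ 1/4 - (831/772 + 25/24)/10 > 1/40`). [cite: LuoTiti2020, §3.2 Prop. 2] -/
theorem coeffSq_pos {R : Fin 3 → Fin 3 → ℝ} (hR : dist R idMat ≤ 2 * radius) (x : PIndex) :
    0 < coeffSq R x := by
  have hR' : dist R idMat ≤ 1 / 10 := hR.trans (by norm_num [radius])
  obtain ⟨h00, h11, h22, h01, h10, h12, h21, h20, h02⟩ := entry_bounds hR'
  rw [abs_le] at h00 h11 h22 h01 h10 h12 h21 h20 h02
  obtain ⟨i, b⟩ := x
  fin_cases i <;> cases b <;> simp [coeffSq, pairSum, offDiag] <;> linarith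

/-- **Uniform positivity on `B̄(Id, ε_γ)`**: `γ_ξ(R)² ≥ 1/8`. [cite: LuoTiti2020, §3.2 Prop. 2] -/
theorem le_coeffSq {R : Fin 3 → Fin 3 → ℝ} (hR : dist R idMat ≤ radius) (x : PIndex) :
    1 / 8 ≤ coeffSq R x := by
  have hR' : dist R idMat ≤ 1 / 20 := hR.trans (by norm_num [radius])
  obtain ⟨h00, h11, h22, h01, h10, h12, h21, h20, h02⟩ := entry_bounds hR'
  rw [abs_le] at h00 h11 h22 h01 h10 h12 h21 h20 h02
  obtain ⟨i, b⟩ := x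
  fin_cases i <;> cases b <;> simp [coeffSq, pairSum, offDiag] <;> linarith

/-- `γ_ξ(R)² = (γ_ξ(R))²` on `B̄(Id, 2ε_γ)`. [folklore] -/
theorem coeff_sq {R : Fin 3 → Fin 3 → ℝ} (hR : dist R idMat ≤ 2 * radius) (x : PIndex) :
    coeff x R ^ 2 = coeffSq R x :=
  Real.sq_sqrt (coeffSq_pos hR x).le

/-- `γ_ξ(R) > 0` on `B̄(Id, 2ε_γ)` ("smooth positive functions"). [cite: LuoTiti2020, §3.2 Prop. 2] -/
theorem coeff_pos {R : Fin 3 → Fin 3 → ℝ} (hR : dist R idMat ≤ 2 * radius) (x : PIndex) :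
    0 < coeff x R :=
  Real.sqrt_pos.mpr (coeffSq_pos hR x)

/-- **Prop. 2, identity (b)**: for every symmetric `R` with `dist R Id ≤ 2ε_γ`,
`R_ab = (1/2) ∑_{ξ ∈ Λ} γ_ξ(R)² (δ_ab - ξ_a ξ_b)`, i.e. `R = (1/2) ∑_Λ γ_ξ(R)² (Id - ξ ⊗ ξ)`
with the genuine (square-root) coefficients `γ_ξ = gamma`. [cite: LuoTiti2020, §3.2 Prop. 2] -/
theorem decomposition {R : Fin 3 → Fin 3 → ℝ} (hsym : ∀ i j, R i j = R j i)
    (hR : dist R idMat ≤ 2 * radius) (a b : Fin 3) :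
    R a b = (1 / 2 : ℝ) * ∑ y : LIndex, gamma y R ^ 2 * ((if a = b then (1 : ℝ) else 0) - dir y a * dir y b) := by
  rw [eq_half_sum_coeffSq R hsym a b]
  congr 1
  exact Finset.sum_congr rfl fun y _ => by rw [gamma, coeff_sq hR]

/-- The same over `Λ⁺`: `R_ab = ∑_{ξ ∈ Λ⁺} γ_ξ(R)² (δ_ab - ξ_a ξ_b)`. [cite: LuoTiti2020, §3.2 Prop. 2] -/
theorem decomposition_plus {R : Fin 3 → Fin 3 → ℝ} (hsym : ∀ i j, R i j = R j i)
    (hR : dist R idMat ≤ 2 * radius) (a b : Fin 3) :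
    R a b = ∑ x : PIndex, coeff x R ^ 2 * ((if a = b then (1 : ℝ) else 0) - dirPlus x a * dirPlus x b) := by
  rw [decomposition hsym hR a b]
  exact half_sum_lIndex (fun x => coeff x R ^ 2) a b

/-! ## Smoothness and derivative bounds -/

/-- Each `γ_ξ²` is `C^∞` on all of `ℝ^{3×3}` (affine in the entries). [folklore] -/
theorem contDiff_coeffSq (x : PIndex) {n : WithTop ℕ∞} :
    ContDiff ℝ n fun R : Fin 3 → Fin 3 → ℝ => coeffSq R x := by
  obtain ⟨i, b⟩ := x
  fin_cases i <;> cases b <;> simp [coeffSq, pairSum, offDiag] <;> fun_prop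

/-- **Each `γ_ξ` is `C^∞` on the open sup-ball `B(Id, 2ε_γ)`** (square root of a smooth
positive function): Luo–Titi's "`γ_ξ ∈ C^∞(B_{ε_γ}(Id))`". [cite: LuoTiti2020, §3.2 Prop. 2] -/
theorem contDiffOn_coeff (x : PIndex) {n : WithTop ℕ∞} :
    ContDiffOn ℝ n (coeff x) (ball (idMat : Fin 3 → Fin 3 → ℝ) (2 * radius)) :=
  (contDiff_coeffSq x).contDiffOn.sqrt fun _ hM => (coeffSq_pos (mem_ball.mp hM).le x).ne'

/-- `γ_ξ` (`ξ ∈ Λ`) is `C^∞` on `B(Id, 2ε_γ)`. [cite: LuoTiti2020, §3.2 Prop. 2] -/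
theorem contDiffOn_gamma (y : LIndex) {n : WithTop ℕ∞} :
    ContDiffOn ℝ n (gamma y) (ball (idMat : Fin 3 → Fin 3 → ℝ) (2 * radius)) :=
  contDiffOn_coeff y.1

/-- **Uniform bounds on all derivatives of `γ_ξ` on `B̄(Id, ε_γ)`** (BV19 Prop. 3.2: "with
derivatives that are bounded"): for every `m` there is `C` with `‖D^m γ_ξ(R)‖ ≤ C` whenever
`dist R Id ≤ ε_γ`. [cite: BuckmasterVicol2019AnnMath, Prop. 3.2] -/
theorem exists_bound_iteratedFDeriv_coeff (x : PIndex) (m : ℕ) :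
    ∃ C : ℝ, ∀ R : Fin 3 → Fin 3 → ℝ, dist R idMat ≤ radius → ‖iteratedFDeriv ℝ m (coeff x) R‖ ≤ C := by
  set U : Set (Fin 3 → Fin 3 → ℝ) := ball idMat (2 * radius) with hU
  have hUopen : IsOpen U := isOpen_ball
  have hsmooth : ContDiffOn ℝ ∞ (coeff x) U := contDiffOn_coeff x
  have hcont : ContinuousOn (iteratedFDerivWithin ℝ m (coeff x) U) U :=
    hsmooth.continuousOn_iteratedFDerivWithin (by exact_mod_cast le_top) hUopen.uniqueDiffOn
  have hcont' : ContinuousOn (iteratedFDeriv ℝ m (coeff x)) U :=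
    hcont.congr fun M hM => (iteratedFDerivWithin_of_isOpen m hUopen hM).symm
  have hsub : closedBall idMat radius ⊆ U := by
    intro M hM
    rw [hU, mem_ball]
    exact (mem_closedBall.mp hM).trans_lt (by norm_num [radius])
  obtain ⟨C, hC⟩ := (isCompact_closedBall idMat radius).exists_bound_of_continuousOn
    (hcont'.mono hsub)
  exact ⟨C, fun M hM => hC M (mem_closedBall.mpr hM)⟩

/-! ## Prop. 2 in its printed shape -/

/-- **Luo–Titi 2020, §3.2, Prop. 2 (= Buckmaster–Vicol 2019, Prop. 3.2 with one family,
`N = 1`), PROVED with explicit data.** *Printed:* "Let `B_ε(Id)` denote the ball of symmetric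
matrices, centered at the identity, of radius `ε`. Then there exist a constant `ε_γ > 0` and
smooth positive functions `γ_(ξ) ∈ C^∞(B_{ε_γ}(Id))`, such that 1. `γ_(ξ) = γ_(-ξ)`; 2. for each
`R ∈ B_{ε_γ}(Id)` we have the identity `R = ½ ∑_{ξ ∈ Λ} (γ_(ξ)(R))² (Id - ξ ⊗ ξ)`."
Here: `ε = radius = 1/20` for the sup-metric on the entries (whose balls contain the
Frobenius/operator balls of the same radius), `Λ` indexed by `LIndex` (`dir`, file
`BeltramiDirections`), `γ_ξ = gamma`: smooth on the open ball `B(Id, 2ε)`, even in `ξ`, positive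
and satisfying the identity on the closed ball `B̄(Id, 2ε)`, with all derivatives bounded on
`B̄(Id, ε)`. [cite: LuoTiti2020, §3.2 Prop. 2] -/
theorem geometric_lemma :
    ∃ ε : ℝ, 0 < ε ∧
      (∀ y : LIndex, ContDiffOn ℝ ∞ (gamma y) (ball (idMat : Fin 3 → Fin 3 → ℝ) (2 * ε))) ∧
      (∀ (x : PIndex) (n : Bool), gamma (x, !n) = gamma (x, n) ∧ dir (x, !n) = -dir (x, n)) ∧
      (∀ (y : LIndex) (R : Fin 3 → Fin 3 → ℝ), dist R idMat ≤ 2 * ε → 0 < gamma y R) ∧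
      (∀ R : Fin 3 → Fin 3 → ℝ, (∀ i j, R i j = R j i) → dist R idMat ≤ 2 * ε →
        ∀ a b, R a b = (1 / 2 : ℝ) * ∑ y : LIndex,
          gamma y R ^ 2 * ((if a = b then (1 : ℝ) else 0) - dir y a * dir y b)) ∧
      ∀ (y : LIndex) (m : ℕ), ∃ C : ℝ, ∀ R : Fin 3 → Fin 3 → ℝ, dist R idMat ≤ ε →
        ‖iteratedFDeriv ℝ m (gamma y) R‖ ≤ C :=
  ⟨radius, by norm_num [radius], fun y => contDiffOn_gamma y, fun x n => ⟨rfl, dir_neg x n⟩,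
    fun y _ hR => coeff_pos hR y.1, fun _ hsym hR a b => decomposition hsym hR a b,
    fun y m => exists_bound_iteratedFDeriv_coeff y.1 m⟩

end Literature.Analysis.FluidPDE.IntermittentBeltrami
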